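import Literature.MathematicalPhysics.QuantumFieldTheory.Balaban1983to89.B12GaugeFixExpansion25

/-!
# `Balaban1983to89.B12GaugeFixExpansion25Holo` — T. Bałaban, *Renormalization group approach to lattice gauge field
theories. I*, Commun. Math. Phys. **109** (1987) 249–301 [Balaban1987RG1]: the expansion (2.5) p. 266 of the
gauge-fixing term in the COMPLEX-ANALYTIC (holomorphic) reading of «G₃(B′) is an analytic function of B′» — companion
of `B12GaugeFixExpansion25` (real reading), PROVED

statement-level skeleton of published theorems with citation tags; proofs where landed; nothing here is a claim about the Yang–Mills mass gap

PDF held: `paper:balaban1987-cmp109-rg-i-small-field` (journal page = PDF page + 248; render `…-p018-x4.png`).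
WHAT IS REPRODUCED: SKELETON row `B12.Eq2.5` of the cell `lit-balaban` (Phase-2 seat p08, companion file; HOME
`run/shared/lean/pub/lit-balaban/lit-balaban-p08/`).  The print and the real (`B′ ∈ 𝔤`, `Ṽ′` unitary) typing of
(2.5) — `G(B′) = Σ_y Σ_{x∈B(y), x≠y} ½|B̃′(y, x)|² + G₃(B′) = ½G⁽²⁾(B′) + G₃(B′)`, `G₃` analytic, of third order,
block-local — are in `B12GaugeFixExpansion25` (`eq25_expansion`).  In the paper «analytic» means analytic on complex
neighbourhoods of the small-field configurations (p. 259–260: the inductive hypotheses are stated for complex `𝔤ᶜ`-valued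
fields; this is how the clause is CONSUMED downstream, e.g. the hypotheses `hG : G₃ =O[𝓝 0] ‖·‖³`, `hGd : G₃`
`ℂ`-differentiable near `0` of `B12ZeroCoupling268.analyticAt_inv_sq_smul` for the term `(1/g_k²)G₃(g_kB)` of (2.12)).
THE TYPING.  Off the unitary group the gauge-fixing density `1 − Re tr U` is continued holomorphically as
`gHol U = 1 − ½ tr(U + U⁻¹)` (`gHol_of_mem_unitaryGroup`: on `U(n)` it IS `1 − Re tr U`, since `U⁻¹ = U*`); for a
holomorphic germ `W : 𝒴 → M_n(ℂ)` (`𝒴` a complex normed space of complexified `B′`) with `W(0) = 1`, the linear term is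
`A = DW(0)Y` (`ℂ`-Fréchet derivative) and the quadratic term of `gHol ∘ W` is `−½ tr A²`, which on skew-Hermitian `A`
(the tangent directions `iX`, `X ∈ 𝔤`, of `U(n)` at `1`) IS `½|A|²` (`neg_half_ntr_sq_of_skewHermitian`) — so (2.5) reads
`gHol(W(Y)) = −½ tr (DW(0)Y)² + g₃(Y)` with `g₃` holomorphic at `0` and `O(‖Y‖³)` (`rem3C_analyticAt`, `rem3C_isBigO`),
and, summed over `y ∈ T⁽ᵏ⁺¹⁾`, `x ∈ B(y) ∖ {y}` for the variables `Ṽ′(y, x)` of p. 266 (`B12GaugeFixExpansion25.tildeV`)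
in a matrix realisation `ρ` of the (complexified) group: `GC = ½G2C + G3C` (`eq25C`), `G3C` holomorphic and of third
order (`G3C_analyticAt`, `G3C_isBigO`), and `GC` IS the gauge-fixing term `Setup.gaugeFixFn` wherever the variables are
unitary (`GC_eq_gaugeFixFn`).  Matrices carry the operator norm of [12] (19) (scope `Matrix.Norms.L2Operator`); only
the complex structure is used (no real-structure convention needed here).
-/

open Filter Asymptotics open scoped Matrix Matrix.Norms.L2Operator Topology

namespace Literature.MathematicalPhysics.QuantumFieldTheory.Balaban1983to89.B12GaugeFixExpansion25Holo

open Literature.MathematicalPhysics.QuantumFieldTheory.Balaban1983to89 UnitaryModel MatrixNorms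
  B12GaugeFixExpansion25

noncomputable section

variable {n : Type*} [Fintype n] [DecidableEq n]

/-! ## 1. The holomorphic gauge-fixing density `1 − ½ tr(U + U⁻¹)` -/

/-- The holomorphic continuation of the gauge-fixing density `1 − Re tr U` off the unitary group:
`gHol U = 1 − ½ tr(U + U⁻¹)` (normalized trace `tr 1 = 1`, (0.2); `U⁻¹` the matrix inverse). [cite: Balaban1987RG1, (2.5) p.266] -/
def gHol (U : Matrix n n ℂ) : ℂ := 1 - (1 / 2) * ntr (U + U⁻¹)

omit [DecidableEq n] in
/-- `tr` is additive. [folklore] -/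
private lemma ntr_add (X Y : Matrix n n ℂ) : ntr (X + Y) = ntr X + ntr Y := by
  simp [ntr, Matrix.trace_add, add_div]

omit [DecidableEq n] in
/-- `tr` respects subtraction. [folklore] -/
private lemma ntr_sub (X Y : Matrix n n ℂ) : ntr (X - Y) = ntr X - ntr Y := by
  simp [ntr, Matrix.trace_sub, sub_div]

/-- On the unitary group the holomorphic density IS the printed one: `1 − ½ tr(U + U⁻¹) = 1 − Re tr U` for
`U ∈ U(n)` (`U⁻¹ = U*`, `tr U* = conj tr U`). [cite: Balaban1987RG1, (0.14) p.254] -/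
theorem gHol_of_mem_unitaryGroup [Nonempty n] {U : Matrix n n ℂ} (hU : U ∈ Matrix.unitaryGroup n ℂ) :
    gHol U = 1 - (nReTr U : ℂ) := by
  have hinv : U⁻¹ = Uᴴ := by
    have h := Matrix.mem_unitaryGroup_iff'.1 hU
    rw [Matrix.star_eq_conjTranspose] at h
    exact Matrix.inv_eq_left_inv h
  have h1 : ntr Uᴴ = starRingEnd ℂ (ntr U) := by
    simp [ntr, Matrix.trace_conjTranspose]
  rw [gHol, hinv, ntr_add, h1, Complex.add_conj, ← ntr_re, Complex.ofReal_mul, Complex.ofReal_ofNat]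
  ring

omit [DecidableEq n] in
/-- The quadratic term: on a skew-Hermitian direction `A = iX` (`X` Hermitian, the tangent space of `U(n)` at `1`),
`−½ tr A² = ½|A|²` with `|·|` the `L²` matrix norm of (0.14)/(2.5). [cite: Balaban1987RG1, (2.5) p.266] -/
theorem neg_half_ntr_sq_of_skewHermitian {A : Matrix n n ℂ} (hA : Aᴴ = -A) :
    -(1 / 2) * ntr (A * A) = (1 / 2) * (nhsNormSq A : ℂ) := by
  have h : ntr (Aᴴ * A) = (nhsNormSq A : ℂ) := nhsInner_self A
  have h' : ntr (-(A * A)) = -ntr (A * A) := by simp [ntr, Matrix.trace_neg, neg_div]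
  rw [hA, neg_mul, h'] at h
  linear_combination (1 / 2 : ℂ) * h

/-! ## 2. One holomorphic germ `W` with `W(0) = 1` -/

variable {𝒴 : Type*} [NormedAddCommGroup 𝒴] [NormedSpace ℂ 𝒴]

/-- Second-order Taylor bound for an analytic germ: `W(x) − W(0) − DW(0)x = O(‖x‖²)`. [folklore] -/
private theorem taylor2_isBigO' {𝕜 : Type*} [NontriviallyNormedField 𝕜] {E' F : Type*} [NormedAddCommGroup E']
    [NormedSpace 𝕜 E'] [NormedAddCommGroup F] [NormedSpace 𝕜 F] {W : E' → F} (hW : AnalyticAt 𝕜 W 0) :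
    (fun x => W x - W 0 - fderiv 𝕜 W 0 x) =O[𝓝 0] fun x => ‖x‖ ^ 2 := by
  obtain ⟨p, hp⟩ := hW
  refine (hp.isBigO_sub_partialSum_pow 2).congr' (Eventually.of_forall fun y => ?_) EventuallyEq.rfl
  have hsnoc : (Fin.snoc (0 : Fin 0 → E') y : Fin 1 → E') = fun _ => y := by
    funext i; fin_cases i; rfl
  simp only [FormalMultilinearSeries.partialSum, Finset.sum_range_succ, Finset.sum_range_zero, zero_add,
    hp.fderiv_eq, continuousMultilinearCurryFin1_apply, hp.coeff_zero, hsnoc]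
  abel

/-- The holomorphic third-order remainder: `g₃(Y) := gHol(W(Y)) + ½ tr (DW(0)Y)²`. [cite: Balaban1987RG1, (2.5) p.266] -/
def rem3C (W : 𝒴 → Matrix n n ℂ) (Y : 𝒴) : ℂ :=
  gHol (W Y) + (1 / 2) * ntr (fderiv ℂ W 0 Y * fderiv ℂ W 0 Y)

/-- (2.5) for one germ, holomorphic reading: `gHol(W(Y)) = −½ tr (DW(0)Y)² + g₃(Y)`. [cite: Balaban1987RG1, (2.5) p.266] -/
theorem gHol_eq (W : 𝒴 → Matrix n n ℂ) (Y : 𝒴) :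
    gHol (W Y) = -(1 / 2) * ntr (fderiv ℂ W 0 Y * fderiv ℂ W 0 Y) + rem3C W Y := by
  rw [rem3C]; ring

/-- The normalized trace as a complex continuous linear functional on `M_n(ℂ)`. [cite: Balaban1987RG1, (0.2) p.252] -/
def ntrL : Matrix n n ℂ →L[ℂ] ℂ :=
  LinearMap.toContinuousLinearMap ((Fintype.card n : ℂ)⁻¹ • Matrix.traceLinearMap n ℂ ℂ)

omit [DecidableEq n] in
/-- `ntrL` is `ntr`. [folklore] -/
@[simp] private lemma ntrL_apply (X : Matrix n n ℂ) : ntrL X = ntr X := by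
  simp [ntrL, ntr, div_eq_inv_mul]

/-- For a holomorphic germ `W` with `W(0) = 1`, `Y ↦ W(Y)⁻¹` is holomorphic at `0` (inversion is analytic at the unit
`1`). [folklore] -/
private theorem analyticAt_inv_comp {W : 𝒴 → Matrix n n ℂ} (hW : AnalyticAt ℂ W 0) (hW0 : W 0 = 1) :
    AnalyticAt ℂ (fun Y => (W Y)⁻¹) 0 := by
  haveI : CompleteSpace (Matrix n n ℂ) := FiniteDimensional.complete ℂ _
  have h1 : AnalyticAt ℂ Ring.inverse (W 0) := by
    rw [hW0]
    exact analyticAt_inverse (𝕜 := ℂ) (1 : (Matrix n n ℂ)ˣ)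
  have h2 := h1.comp hW
  refine h2.congr (Eventually.of_forall fun Y => ?_)
  exact (Matrix.nonsing_inv_eq_ringInverse (W Y)).symm

/-- The remainder `g₃` is holomorphic at `0` when `W` is, `W(0) = 1` («G₃(B′) is an analytic function of B′»).
[cite: Balaban1987RG1, (2.5) p.266] -/
theorem rem3C_analyticAt {W : 𝒴 → Matrix n n ℂ} (hW : AnalyticAt ℂ W 0) (hW0 : W 0 = 1) :
    AnalyticAt ℂ (rem3C W) 0 := by
  unfold rem3C gHol
  refine (analyticAt_const.sub (analyticAt_const.mul ?_)).add (analyticAt_const.mul ?_)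
  · have h := (ntrL (n := n)).analyticAt _ |>.comp (hW.add (analyticAt_inv_comp hW hW0))
    exact h.congr (Eventually.of_forall fun Y => by simp)
  · have hA := (fderiv ℂ W 0).analyticAt (0 : 𝒴)
    have h := (ntrL (n := n)).analyticAt _ |>.comp (hA.mul hA)
    exact h.congr (Eventually.of_forall fun Y => by simp)

/-- The inverse expanded to second order: if `Wi·W = 1` and `Z := W − 1`, then `W + Wi = 2 + Z² − Wi·Z³`. [folklore] -/
private lemma add_inv_expand {W Wi : Matrix n n ℂ} (h2 : Wi * W = 1) :
    W + Wi = 1 + 1 + (W - 1) * (W - 1) - Wi * ((W - 1) * (W - 1) * (W - 1)) := by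
  have key : W * (1 - (W - 1) + (W - 1) * (W - 1)) = 1 + (W - 1) * (W - 1) * (W - 1) := by noncomm_ring
  have h3 : 1 - (W - 1) + (W - 1) * (W - 1) = Wi + Wi * ((W - 1) * (W - 1) * (W - 1)) := by
    have := congrArg (fun M => Wi * M) key
    simpa only [← mul_assoc, h2, one_mul, mul_add, mul_one] using this
  have hWi : Wi = 1 - (W - 1) + (W - 1) * (W - 1) - Wi * ((W - 1) * (W - 1) * (W - 1)) :=
    eq_sub_of_add_eq h3.symm
  conv_lhs => rw [hWi]
  noncomm_ring

/-- Pointwise form of the remainder: for `W` with `W⁻¹W = 1`, `Z = W − 1`, `R = Z − A`: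
`gHol W + ½ tr A² = −½ tr(AR + RA + R²) + ½ tr(W⁻¹Z³)`. [folklore] -/
private lemma gHol_add_half_ntr_sq [Nonempty n] {W : Matrix n n ℂ} (h2 : W⁻¹ * W = 1) (A : Matrix n n ℂ) :
    gHol W + (1 / 2) * ntr (A * A) =
      -(1 / 2) * ntr (A * (W - 1 - A) + (W - 1 - A) * A + (W - 1 - A) * (W - 1 - A))
        + (1 / 2) * ntr (W⁻¹ * ((W - 1) * (W - 1) * (W - 1))) := by
  have hZZ : ntr ((W - 1) * (W - 1)) =
      ntr (A * A) + ntr (A * (W - 1 - A) + (W - 1 - A) * A + (W - 1 - A) * (W - 1 - A)) := by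
    rw [← ntr_add]
    congr 1
    noncomm_ring
  rw [gHol, add_inv_expand h2, ntr_sub, ntr_add, ntr_add, ntr_one, hZZ]
  ring

/-- `‖W⁻¹‖ ≤ 2` when `‖W − 1‖ < ½` (from `W⁻¹ = 1 − W⁻¹(W − 1)`). [folklore] -/
private lemma norm_inv_le_two [Nonempty n] {W : Matrix n n ℂ} (h2 : W⁻¹ * W = 1) (hZ : ‖W - 1‖ < 1 / 2) :
    ‖W⁻¹‖ ≤ 2 := by
  have hid : W⁻¹ = 1 - W⁻¹ * (W - 1) := by rw [mul_sub, mul_one, h2]; abel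
  have hle : ‖W⁻¹‖ ≤ ‖(1 : Matrix n n ℂ)‖ + ‖W⁻¹ * (W - 1)‖ := by
    conv_lhs => rw [hid]
    exact norm_sub_le _ _
  have hmul : ‖W⁻¹ * (W - 1)‖ ≤ ‖W⁻¹‖ * ‖W - 1‖ := Matrix.l2_opNorm_mul _ _
  have h1n : ‖(1 : Matrix n n ℂ)‖ = 1 := norm_of_mem_unitaryGroup (Submonoid.one_mem (Matrix.unitaryGroup n ℂ))
  nlinarith [norm_nonneg W⁻¹, norm_nonneg (W - 1)]

/-- Pointwise bound on the remainder for `‖W − 1‖ < ½` and any `A`, with `R = W − 1 − A`: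
`|gHol W + ½ tr A²| ≤ ½(2‖A‖‖R‖ + ‖R‖²) + ‖W − 1‖³`. [folklore] -/
private lemma norm_gHol_add_half_ntr_sq_le [Nonempty n] {W : Matrix n n ℂ} (hZ : ‖W - 1‖ < 1 / 2)
    (A : Matrix n n ℂ) :
    ‖gHol W + (1 / 2) * ntr (A * A)‖ ≤
      (1 / 2) * (2 * ‖A‖ * ‖W - 1 - A‖ + ‖W - 1 - A‖ ^ 2) + ‖W - 1‖ ^ 3 := by
  haveI : CompleteSpace (Matrix n n ℂ) := FiniteDimensional.complete ℂ _
  have hunit : IsUnit W := by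
    have h : ‖-(W - 1)‖ < 1 := by rw [norm_neg]; linarith
    simpa using isUnit_one_sub_of_norm_lt_one h
  have h2 : W⁻¹ * W = 1 := Matrix.nonsing_inv_mul _ ((Matrix.isUnit_iff_isUnit_det _).mp hunit)
  rw [gHol_add_half_ntr_sq h2 A]
  refine (norm_add_le _ _).trans (add_le_add ?_ ?_)
  · rw [norm_mul, show ‖(-(1 / 2) : ℂ)‖ = 1 / 2 by simp]
    refine mul_le_mul_of_nonneg_left ?_ (by norm_num)
    calc ‖ntr (A * (W - 1 - A) + (W - 1 - A) * A + (W - 1 - A) * (W - 1 - A))‖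
        ≤ ‖A * (W - 1 - A) + (W - 1 - A) * A + (W - 1 - A) * (W - 1 - A)‖ := norm_ntr_le_opNorm _
      _ ≤ ‖A * (W - 1 - A)‖ + ‖(W - 1 - A) * A‖ + ‖(W - 1 - A) * (W - 1 - A)‖ := norm_add₃_le
      _ ≤ ‖A‖ * ‖W - 1 - A‖ + ‖W - 1 - A‖ * ‖A‖ + ‖W - 1 - A‖ * ‖W - 1 - A‖ := by
        gcongr <;> exact Matrix.l2_opNorm_mul _ _
      _ = 2 * ‖A‖ * ‖W - 1 - A‖ + ‖W - 1 - A‖ ^ 2 := by ring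
  · rw [norm_mul, show ‖((1 / 2) : ℂ)‖ = 1 / 2 by simp]
    have hZ2 : ‖(W - 1) * (W - 1)‖ ≤ ‖W - 1‖ * ‖W - 1‖ := Matrix.l2_opNorm_mul _ _
    have hZ3 : ‖(W - 1) * (W - 1) * (W - 1)‖ ≤ ‖W - 1‖ * ‖W - 1‖ * ‖W - 1‖ :=
      (Matrix.l2_opNorm_mul _ _).trans (mul_le_mul_of_nonneg_right hZ2 (norm_nonneg _))
    have h3 : ‖ntr (W⁻¹ * ((W - 1) * (W - 1) * (W - 1)))‖ ≤ 2 * ‖W - 1‖ ^ 3 :=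
      calc ‖ntr (W⁻¹ * ((W - 1) * (W - 1) * (W - 1)))‖ ≤ ‖W⁻¹ * ((W - 1) * (W - 1) * (W - 1))‖ :=
            norm_ntr_le_opNorm _
        _ ≤ ‖W⁻¹‖ * ‖(W - 1) * (W - 1) * (W - 1)‖ := Matrix.l2_opNorm_mul _ _
        _ ≤ 2 * (‖W - 1‖ * ‖W - 1‖ * ‖W - 1‖) :=
            mul_le_mul (norm_inv_le_two h2 hZ) hZ3 (norm_nonneg _) (by norm_num)
        _ = 2 * ‖W - 1‖ ^ 3 := by ring
    nlinarith [h3, norm_nonneg (W - 1)]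

/-- The remainder `g₃` is of third order («with an expansion beginning with third order terms»): for a holomorphic germ
`W` at `0` with `W(0) = 1`, `g₃(Y) = O(‖Y‖³)` — with `Z = W − 1 = A + R`, `A = DW(0)Y = O(‖Y‖)`, `R = O(‖Y‖²)`:
`gHol(W) = −½ tr Z² + ½ tr W⁻¹Z³` (geometric expansion of the inverse) and `Z² = A² + (AR + RA + R²)`.
[cite: Balaban1987RG1, (2.5) p.266] -/
theorem rem3C_isBigO [Nonempty n] {W : 𝒴 → Matrix n n ℂ} (hW : AnalyticAt ℂ W 0) (hW0 : W 0 = 1) :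
    rem3C W =O[𝓝 0] fun Y => ‖Y‖ ^ 3 := by
  have hR : (fun Y => W Y - 1 - fderiv ℂ W 0 Y) =O[𝓝 0] fun Y => ‖Y‖ ^ 2 := by
    simpa only [hW0] using taylor2_isBigO' hW
  have hA : (fun Y => ‖fderiv ℂ W 0 Y‖) =O[𝓝 0] fun Y => ‖Y‖ :=
    ((fderiv ℂ W 0).isBigO_id (𝓝 0)).norm_left.norm_right
  have hZ : (fun Y => ‖W Y - 1‖) =O[𝓝 0] fun Y => ‖Y‖ := by
    have h := hW.differentiableAt.isBigO_sub
    rw [hW0] at h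
    exact (h.norm_left.congr_right fun Y => by rw [sub_zero]).norm_right
  have hZsmall : ∀ᶠ Y in 𝓝 0, ‖W Y - 1‖ < 1 / 2 := by
    have hc : ContinuousAt (fun Y => W Y - 1) 0 := hW.continuousAt.sub continuousAt_const
    have ht : Tendsto (fun Y => W Y - 1) (𝓝 0) (𝓝 0) := by simpa [ContinuousAt, hW0] using hc
    exact (NormedAddGroup.tendsto_nhds_zero.mp ht) (1 / 2) (by norm_num)
  have hpt : ∀ᶠ Y in 𝓝 0, ‖rem3C W Y‖ ≤ 1 * ‖(1 / 2) * (2 * ‖fderiv ℂ W 0 Y‖ * ‖W Y - 1 - fderiv ℂ W 0 Y‖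
      + ‖W Y - 1 - fderiv ℂ W 0 Y‖ ^ 2) + ‖W Y - 1‖ ^ 3‖ := by
    filter_upwards [hZsmall] with Y hY
    rw [one_mul, Real.norm_of_nonneg (by positivity)]
    exact norm_gHol_add_half_ntr_sq_le hY _
  refine (IsBigO.of_bound 1 hpt).trans ?_
  have h4 : (fun Y : 𝒴 => ‖Y‖ ^ 4) =O[𝓝 0] fun Y => ‖Y‖ ^ 3 := by
    refine IsBigO.of_bound 1 ?_
    filter_upwards [Metric.ball_mem_nhds (0 : 𝒴) one_pos] with Y hY
    rw [Metric.mem_ball, dist_zero_right] at hY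
    rw [Real.norm_of_nonneg (by positivity), Real.norm_of_nonneg (by positivity), one_mul, pow_succ]
    exact mul_le_of_le_one_right (by positivity) hY.le
  have hAR : (fun Y => 2 * ‖fderiv ℂ W 0 Y‖ * ‖W Y - 1 - fderiv ℂ W 0 Y‖) =O[𝓝 0] fun Y => ‖Y‖ ^ 3 :=
    ((hA.mul hR.norm_left).const_mul_left 2).congr (fun Y => by ring) (fun Y => by ring)
  have hRR : (fun Y => ‖W Y - 1 - fderiv ℂ W 0 Y‖ ^ 2) =O[𝓝 0] fun Y => ‖Y‖ ^ 3 :=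
    ((hR.norm_left.pow 2).congr_right fun Y => by ring).trans h4
  exact ((hAR.add hRR).const_mul_left (1 / 2)).add (hZ.pow 3)

/-! ## 3. The display summed over the lattice (`Setup`), holomorphic reading -/

variable {P : Params} {k : ℕ} {G : Type*} [GaugeGroup G]
variable (ρ : G →* Matrix n n ℂ) (cd : ContourData P k G) (Vk : GaugeField P k G) (pert : 𝒴 → GaugeField P k G)

omit [NormedAddCommGroup 𝒴] [NormedSpace ℂ 𝒴] in
/-- `GC(B′) := Σ_{y∈Y} Σ_{x∈B(y), x≠y} [1 − ½ tr(Ṽ′(y, x)(B′) + Ṽ′(y, x)(B′)⁻¹)]`: the gauge-fixing term of (2.1)/(2.5) in the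
variables `Ṽ′(y, x)` of p. 266 (`B12GaugeFixExpansion25.tildeV`), continued holomorphically (`gHol`), in a matrix
realisation `ρ` of the group (`G` or its complexification). [cite: Balaban1987RG1, (2.5) p.266] -/
def GC (Y : Finset (Site P (k+1))) (B' : 𝒴) : ℂ :=
  ∑ y ∈ Y, ∑ x ∈ (block y).erase (emb y), gHol (ρ (tildeV cd Vk pert B' y x))

/-- The quadratic part, holomorphic reading: `G2C(B′) = Σ_y Σ_x (−tr (B̃′(y, x)B′)²)`, `B̃′(y, x) = D[ρ ∘ Ṽ′(y, x)](0)`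
(`= Σ|B̃′(y, x)B′|²` on skew-Hermitian directions, `neg_half_ntr_sq_of_skewHermitian`). [cite: Balaban1987RG1, (2.5) p.266] -/
def G2C (Y : Finset (Site P (k+1))) (B' : 𝒴) : ℂ :=
  ∑ y ∈ Y, ∑ x ∈ (block y).erase (emb y),
    -ntr (fderiv ℂ (fun B'' => ρ (tildeV cd Vk pert B'' y x)) 0 B' *
      fderiv ℂ (fun B'' => ρ (tildeV cd Vk pert B'' y x)) 0 B')

/-- The block term `G₃,y` of the third-order part, holomorphic reading. [cite: Balaban1987RG1, (2.5) p.266] -/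
def G3Cblock (y : Site P (k+1)) (B' : 𝒴) : ℂ :=
  ∑ x ∈ (block y).erase (emb y), rem3C (fun B'' => ρ (tildeV cd Vk pert B'' y x)) B'

/-- `G3C = Σ_y G₃,y`, the third-order part, holomorphic reading. [cite: Balaban1987RG1, (2.5) p.266] -/
def G3C (Y : Finset (Site P (k+1))) (B' : 𝒴) : ℂ := ∑ y ∈ Y, G3Cblock ρ cd Vk pert y B'

/-- **(2.5)**, holomorphic reading, the identity: `GC(B′) = ½G2C(B′) + G3C(B′)`. [cite: Balaban1987RG1, (2.5) p.266] -/
theorem eq25C (Y : Finset (Site P (k+1))) (B' : 𝒴) :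
    GC ρ cd Vk pert Y B' = (1 / 2) * G2C ρ cd Vk pert Y B' + G3C ρ cd Vk pert Y B' := by
  unfold GC G2C G3C G3Cblock
  rw [Finset.mul_sum, ← Finset.sum_add_distrib]
  refine Finset.sum_congr rfl fun y _ => ?_
  rw [Finset.mul_sum, ← Finset.sum_add_distrib]
  refine Finset.sum_congr rfl fun x _ => ?_
  have h := gHol_eq (fun B'' => ρ (tildeV cd Vk pert B'' y x)) B'
  beta_reduce at h
  rw [h]
  ring

/-- **(2.5)**, holomorphic reading: `G3C` is holomorphic at `B′ = 0` when the variables `Ṽ′(y, x)` are and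
`V′V⁽ᵏ⁾ = V⁽ᵏ⁾` at `B′ = 0`. [cite: Balaban1987RG1, (2.5) p.266] -/
theorem G3C_analyticAt (hpert0 : pert 0 = Vk) (Y : Finset (Site P (k+1)))
    (han : ∀ y ∈ Y, ∀ x ∈ (block y).erase (emb y), AnalyticAt ℂ (fun B' => ρ (tildeV cd Vk pert B' y x)) 0) :
    AnalyticAt ℂ (G3C ρ cd Vk pert Y) 0 :=
  Finset.analyticAt_fun_sum _ fun y hy => Finset.analyticAt_fun_sum _ fun x hx =>
    rem3C_analyticAt (han y hy x hx) (by simp [tildeV, hpert0])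

/-- **(2.5)**, holomorphic reading: `G3C(B′) = O(‖B′‖³)` («expansion beginning with third order terms»).
[cite: Balaban1987RG1, (2.5) p.266] -/
theorem G3C_isBigO [Nonempty n] (hpert0 : pert 0 = Vk) (Y : Finset (Site P (k+1)))
    (han : ∀ y ∈ Y, ∀ x ∈ (block y).erase (emb y), AnalyticAt ℂ (fun B' => ρ (tildeV cd Vk pert B' y x)) 0) :
    G3C ρ cd Vk pert Y =O[𝓝 0] fun B' => ‖B'‖ ^ 3 :=
  IsBigO.sum fun y hy => IsBigO.sum fun x hx => rem3C_isBigO (han y hy x hx) (by simp [tildeV, hpert0])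

omit [NormedAddCommGroup 𝒴] [NormedSpace ℂ 𝒴] in
/-- The holomorphic `GC` IS the printed gauge-fixing term `G = Setup.gaugeFixFn` at the configurations where the
variables `Ṽ′(y, x)` are unitary (the real small-field configurations), for `V⁽ᵏ⁾` in the block axial gauge and
`reTr = Re tr ∘ ρ`. [cite: Balaban1987RG1, (2.5) p.266] -/
theorem GC_eq_gaugeFixFn [Nonempty n] (hρtr : ∀ g : G, reTr g = nReTr (ρ g)) (hax : AxialGauge cd Vk)
    (Y : Finset (Site P (k+1))) (B' : 𝒴)
    (hU : ∀ y ∈ Y, ∀ x ∈ (block y).erase (emb y), ρ (tildeV cd Vk pert B' y x) ∈ Matrix.unitaryGroup n ℂ) :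
    GC ρ cd Vk pert Y B' = (gaugeFixFn cd Y (pert B') : ℂ) := by
  unfold GC gaugeFixFn
  rw [Complex.ofReal_sum]
  refine Finset.sum_congr rfl fun y hy => ?_
  rw [Complex.ofReal_sum]
  refine Finset.sum_congr rfl fun x hx => ?_
  have hx' : blockOf x = y ∧ x ≠ emb y := by
    rw [Finset.mem_erase, block, Finset.mem_filter] at hx
    exact ⟨hx.2.2, hx.1⟩
  have htv : tildeV cd Vk pert B' y x = cd.holTo (pert B') y x := by
    rw [tildeV, hax y x hx'.1 hx'.2, inv_one, mul_one]
  rw [gHol_of_mem_unitaryGroup (hU y hy x hx), hρtr, htv, Complex.ofReal_sub, Complex.ofReal_one]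

end

end Literature.MathematicalPhysics.QuantumFieldTheory.Balaban1983to89.B12GaugeFixExpansion25Holo
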